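import Mathlib.RingTheory.PowerSeries.Log
import Mathlib.RingTheory.PowerSeries.Exp
import Mathlib.RingTheory.PowerSeries.Derivative
import Mathlib.RingTheory.PowerSeries.Inverse
import Mathlib.RingTheory.PowerSeries.Trunc
import Mathlib.RingTheory.PowerSeries.Substitution
import Mathlib.RingTheory.Nilpotent.Exp
import Mathlib.Algebra.Polynomial.AlgebraMap
import Mathlib.Algebra.Polynomial.Div
import Mathlib.Algebra.Ring.Action.Basic
import Mathlib.Algebra.Algebra.Rat
import HarnessLib

/-!
# The truncated logarithm of a unipotent element: `exp (log (1 + x)) = 1 + x`, `log (exp x) = x`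
# for nilpotent `x` in a `ℚ`-algebra

Mathlib has the exponential of a nilpotent element (`IsNilpotent.exp`, `IsNilpotent.exp_add_of_commute`)
but no logarithm.  For a nilpotent `x` (`x ^ m = 0`) in a `ℚ`-algebra `B` the **truncated logarithm**
of the unipotent element `1 + x` is the finite sum `∑_{k < m} (-1)^(k+1) x^k / k`; it is written out as
that explicit sum throughout (no new definition is introduced).  This file proves the exp/log
dictionary for it, by transferring the power-series identities `exp ∘ log (1 + X) = 1 + X` and
`log (1 + (exp X - 1)) = X` in `ℚ⟦X⟧` (proved here by differentiation, Mathlib's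
`PowerSeries.derivative`) to nilpotent elements:

* `exp_logSum`: `exp (log (1 + x)) = 1 + x`;  `logSum_exp_sub_one`: `log (exp x) = x`;
* `logSum_pow_eq_zero` (the logarithm is again nilpotent), `logSum_mul_of_commute`
  (`log ((1+x)(1+y)) = log (1+x) + log (1+y)` for commuting nilpotents), `commute_logSum`,
  `smul_logSum` (equivariance under ring automorphisms), `logSum_zero`;
* transfer lemmas `aeval_eq_of_coeff_eq_of_pow_eq_zero`, `coeff_trunc_subst`, and the series
  identities `one_add_X_mul_geom`, `eq_zero_of_derivative_eq_mul`, `exp_subst_log`,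
  `log_subst_exp_sub_one`.

Provenance: this is the Mathlib-only block formerly at the head of
`Literature/NumberTheory/GaloisRepresentations/WeilDeligneRepLadicProofs.lean` (namespace `…Ladic`,
sections `Transfer` / `PowerSeriesIdentities` / `Log`), moved VERBATIM into its own base module so that
users of the exp/log dictionary (the Weil–Deligne dictionary there; the Grassmann effective action of
`Literature/MathematicalPhysics/QuantumLattice/GrassmannEffectiveAction`) need not import 27 Galois
modules (definition item `defn-NilpotentExpLog`).  Namespace: `Literature.RingTheory.PowerSeries.NilpotentLog`.

## References

* N. Bourbaki, *Groupes et algèbres de Lie*, Ch. II §6 no. 1 (exponential and logarithm of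
  nilpotent / unipotent elements).
* J.-P. Serre, J. Tate, *Good reduction of abelian varieties*, Ann. of Math. 88 (1968), Appendix
  (the logarithm of a unipotent automorphism). [SerreTate1968GoodReduction]
-/

noncomputable section

open Polynomial

namespace Literature.RingTheory.PowerSeries.NilpotentLog

/-! ### The truncated logarithm (exp/log for nilpotent elements of a `ℚ`-algebra) -/

section Transfer

/-- If two polynomials agree in degrees `< m` then they have the same value at an element `x`
with `x ^ m = 0`. [folklore] -/
theorem aeval_eq_of_coeff_eq_of_pow_eq_zero {R B : Type*} [CommRing R] [Ring B] [Algebra R B]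
    {p q : R[X]} {m : ℕ} (h : ∀ n < m, p.coeff n = q.coeff n) {x : B} (hx : x ^ m = 0) :
    aeval x p = aeval x q := by
  have hdvd : (Polynomial.X : R[X]) ^ m ∣ p - q := by
    rw [Polynomial.X_pow_dvd_iff]
    intro d hd
    rw [coeff_sub, h d hd, sub_self]
  obtain ⟨r, hr⟩ := hdvd
  rw [← sub_eq_zero, ← map_sub, hr, map_mul, map_pow, aeval_X, hx, zero_mul]

open _root_.PowerSeries in
/-- The coefficients below `m` of a substitution `f ∘ g` of power series (`g` without constant
term) are those of the composition of the truncations. [folklore] -/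
theorem coeff_trunc_subst {R : Type*} [CommRing R] {f g : R⟦X⟧}
    (hg : PowerSeries.constantCoeff g = 0) {m n : ℕ} (hn : n < m) :
    (trunc m (f.subst g)).coeff n = ((trunc m f).comp (trunc m g)).coeff n := by
  have hg' : HasSubst g := HasSubst.of_constantCoeff_zero' hg
  rw [coeff_trunc, if_pos hn, coeff_subst' hg']
  -- powers `g ^ d`, `d ≥ m`, do not contribute below `m`
  have hvan : ∀ d, m ≤ d → PowerSeries.coeff n (g ^ d) = 0 := by
    intro d hd
    have hX : (PowerSeries.X : R⟦X⟧) ^ d ∣ g ^ d :=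
      pow_dvd_pow_of_dvd (PowerSeries.X_dvd_iff.mpr hg) d
    exact (PowerSeries.X_pow_dvd_iff.mp hX) n (lt_of_lt_of_le hn hd)
  rw [finsum_eq_sum_of_support_subset _ (s := Finset.range m)]
  swap
  · intro d hd
    rw [Function.mem_support] at hd
    rw [Finset.coe_range, Set.mem_Iio]
    by_contra hdm
    exact hd (by rw [hvan d (not_lt.mp hdm), smul_zero])
  rcases Nat.eq_zero_or_pos m with rfl | hm
  · exact absurd hn (Nat.not_lt_zero _)
  have hdeg : (trunc m f).natDegree < m := by
    obtain ⟨k, rfl⟩ := Nat.exists_eq_succ_of_ne_zero hm.ne'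
    exact natDegree_trunc_lt f k
  rw [Polynomial.comp_eq_sum_left,
    Polynomial.sum_over_range' _ (fun e => by rw [map_zero, zero_mul]) m hdeg,
    Polynomial.finsetSum_coeff]
  refine Finset.sum_congr rfl fun d hd => ?_
  rw [Finset.mem_range] at hd
  rw [Polynomial.coeff_C_mul, coeff_trunc, if_pos hd, smul_eq_mul]
  congr 1
  rw [← coeff_coe_trunc_of_lt hn, ← trunc_trunc_pow, coeff_coe_trunc_of_lt hn,
    ← Polynomial.coe_pow, Polynomial.coeff_coe]

end Transfer

section PowerSeriesIdentities

open _root_.PowerSeries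

/-- `(1 + X) · ∑ (-1)^n X^n = 1`. [folklore] -/
theorem one_add_X_mul_geom :
    ((1 : ℚ⟦X⟧) + PowerSeries.X) * (PowerSeries.mk fun n => ((-1 : ℚ) ^ n)) = 1 := by
  ext n
  rcases n with _ | n
  · simp
  · rw [add_mul, one_mul, map_add, coeff_mk, PowerSeries.coeff_one, PowerSeries.coeff_succ_X_mul,
      coeff_mk]
    simp [pow_succ]

/-- Uniqueness for the linear differential equation `u' = u · g` with `u(0) = 0`: `u = 0`
(coefficient recursion). [folklore] -/
theorem eq_zero_of_derivative_eq_mul {u g : ℚ⟦X⟧} (hu : d⁄dX ℚ u = u * g)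
    (h0 : PowerSeries.constantCoeff u = 0) : u = 0 := by
  suffices h : ∀ n, ∀ k ≤ n, PowerSeries.coeff k u = 0 by
    ext n; exact h n n le_rfl
  intro n
  induction n with
  | zero =>
    intro k hk
    rw [Nat.le_zero.mp hk, coeff_zero_eq_constantCoeff, h0]
  | succ n ih =>
    intro k hk
    rcases Nat.lt_or_ge k (n + 1) with hlt | hge
    · exact ih k (Nat.lt_succ_iff.mp hlt)
    · have hk' : k = n + 1 := le_antisymm hk hge
      subst hk'
      have h1 : PowerSeries.coeff n (d⁄dX ℚ u) = PowerSeries.coeff n (u * g) := by rw [hu]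
      rw [PowerSeries.coeff_derivative, PowerSeries.coeff_mul] at h1
      have h2 : ∑ p ∈ Finset.antidiagonal n,
          PowerSeries.coeff p.1 u * PowerSeries.coeff p.2 g = 0 := by
        refine Finset.sum_eq_zero fun p hp => ?_
        have hp1 : p.1 ≤ n := by
          have := Finset.mem_antidiagonal.mp hp
          omega
        rw [ih p.1 hp1, zero_mul]
      rw [h2] at h1
      have h3 : ((n : ℚ) + 1) ≠ 0 := by positivity
      exact (mul_eq_zero.mp h1).resolve_right h3

/-- **`exp (log (1 + X)) = 1 + X`** in `ℚ⟦X⟧`: both sides solve `(1 + X) y' = y`, `y(0) = 1`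
(`PowerSeries.derivative_subst`, `derivative_exp`, `deriv_log`). [folklore] -/
theorem exp_subst_log : (exp ℚ).subst (log ℚ) = 1 + PowerSeries.X := by
  set f := (exp ℚ).subst (log ℚ) with hf
  set g : ℚ⟦X⟧ := PowerSeries.mk fun n => ((-1 : ℚ) ^ n) with hg
  have hlog : HasSubst (log ℚ) := HasSubst.log
  have hg' : (PowerSeries.mk fun n => algebraMap ℚ ℚ ((-1 : ℚ) ^ n)) = g := by
    ext n; simp [hg]
  have hdf : d⁄dX ℚ f = f * g := by
    rw [hf, derivative_subst _ hlog, derivative_exp, deriv_log, hg']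
  have hd1 : d⁄dX ℚ ((1 : ℚ⟦X⟧) + PowerSeries.X) = (1 + PowerSeries.X) * g := by
    rw [map_add, Derivation.map_one_eq_zero, PowerSeries.derivative_X, zero_add, hg,
      one_add_X_mul_geom]
  have hu' : d⁄dX ℚ (f - (1 + PowerSeries.X)) = (f - (1 + PowerSeries.X)) * g := by
    rw [map_sub, hdf, hd1, sub_mul]
  have h0 : PowerSeries.constantCoeff (f - (1 + PowerSeries.X)) = 0 := by
    rw [map_sub, map_add, map_one, constantCoeff_X, add_zero, hf,
      ← coeff_zero_eq_constantCoeff_apply, coeff_subst' hlog, finsum_eq_single _ 0]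
    · simp
    · intro d hd
      rw [coeff_zero_eq_constantCoeff_apply, map_pow, constantCoeff_log, zero_pow hd, smul_zero]
  have := eq_zero_of_derivative_eq_mul hu' h0
  rwa [sub_eq_zero] at this

/-- **`log (1 + (exp X - 1)) = X`** in `ℚ⟦X⟧`: both sides have derivative `1` and vanish at `0`
(`PowerSeries.derivative.ext`). [folklore] -/
theorem log_subst_exp_sub_one : (log ℚ).subst (exp ℚ - 1) = PowerSeries.X := by
  have he : HasSubst (exp ℚ - 1) := HasSubst.exp_sub_one
  set g : ℚ⟦X⟧ := PowerSeries.mk fun n => ((-1 : ℚ) ^ n) with hg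
  have hg' : (PowerSeries.mk fun n => algebraMap ℚ ℚ ((-1 : ℚ) ^ n)) = g := by
    ext n; simp [hg]
  apply derivative.ext
  · rw [derivative_subst _ he, deriv_log, map_sub, Derivation.map_one_eq_zero, sub_zero,
      derivative_exp, PowerSeries.derivative_X, hg']
    have h1 : ((1 : ℚ⟦X⟧) + PowerSeries.X).subst (exp ℚ - 1) * g.subst (exp ℚ - 1) = 1 := by
      rw [← subst_mul he, hg, one_add_X_mul_geom, ← coe_substAlgHom he, map_one]
    have h2 : ((1 : ℚ⟦X⟧) + PowerSeries.X).subst (exp ℚ - 1) = exp ℚ := by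
      rw [← coe_substAlgHom he, map_add, map_one, coe_substAlgHom, subst_X he, add_sub_cancel]
    rw [h2] at h1
    rw [mul_comm]
    exact h1
  · rw [constantCoeff_X]
    refine constantCoeff_subst_eq_zero ?_ _ constantCoeff_log
    show MvPowerSeries.constantCoeff (exp ℚ - 1) = 0
    rw [map_sub, map_one, sub_eq_zero]
    exact constantCoeff_exp

end PowerSeriesIdentities

section Log

open _root_.PowerSeries (trunc coeff_trunc eval₂_trunc_eq_sum_range coeff_log coeff_exp constantCoeff_log
  constantCoeff_exp trunc_sub trunc_one coeff_zero_eq_constantCoeff log exp)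

variable {B : Type*} [Ring B] [Algebra ℚ B]

/-! The **truncated logarithm** of a unipotent element `1 + x` of a `ℚ`-algebra is written
throughout as the explicit finite sum `∑_{k < m} (-1)^(k+1) x^k / k` (the `k = 0` term is `0`
since `(-1)/0 = 0` in `ℚ`), at a level `m` with `x ^ m = 0`; no new definition is introduced
(Mathlib has `IsNilpotent.exp` but no logarithm).  Ref: Bourbaki, *Groupes et algèbres de
Lie*, Ch. II §6 no. 1; Serre–Tate, Ann. of Math. 88 (1968), Appendix (the logarithm of a
unipotent automorphism). -/

/-- The truncated logarithm sum is the value at `x` of the truncated logarithm series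
`PowerSeries.log`. [folklore] -/
theorem logSum_eq_aeval (x : B) (m : ℕ) :
    (∑ k ∈ Finset.range m, (((-1 : ℚ) ^ (k + 1)) / k) • x ^ k) = aeval x (trunc m (log ℚ)) := by
  rw [Polynomial.aeval_def, eval₂_trunc_eq_sum_range]
  refine Finset.sum_congr rfl fun k _ => ?_
  rw [coeff_log, Algebra.smul_def]
  congr 1
  split_ifs with hk
  · subst hk; simp
  · simp

/-- `exp y` is the value at `y` of the truncated exponential series. [folklore] -/
theorem exp_eq_aeval {y : B} {m : ℕ} (h : y ^ m = 0) :
    IsNilpotent.exp y = aeval y (trunc m (exp ℚ)) := by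
  rw [IsNilpotent.exp_eq_sum h, Polynomial.aeval_def, eval₂_trunc_eq_sum_range]
  refine Finset.sum_congr rfl fun k _ => ?_
  rw [coeff_exp, Algebra.smul_def, one_div]
  simp

/-- Values of polynomials at `x` commute with `x`. [folklore] -/
theorem commute_aeval (x : B) (r : ℚ[X]) : Commute x (aeval x r) := by
  have h1 : aeval x (Polynomial.X * r) = x * aeval x r := by rw [map_mul, aeval_X]
  have h2 : aeval x (r * Polynomial.X) = aeval x r * x := by rw [map_mul, aeval_X]
  rw [mul_comm, h2] at h1
  exact h1.symm

/-- The value at `x`, `x ^ m = 0`, of a polynomial without constant term has `m`-th power `0`.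
[folklore] -/
theorem aeval_pow_eq_zero_of_coeff_zero {p : ℚ[X]} (hp : p.coeff 0 = 0) {x : B} {m : ℕ}
    (hx : x ^ m = 0) : (aeval x p) ^ m = 0 := by
  obtain ⟨r, hr⟩ := Polynomial.X_dvd_iff.mpr hp
  rw [hr, map_mul, aeval_X, (commute_aeval x r).mul_pow, hx, zero_mul]

/-- The truncated logarithm of `1 + x`, `x ^ m = 0`, has `m`-th power `0`. [folklore] -/
theorem logSum_pow_eq_zero {x : B} {m : ℕ} (h : x ^ m = 0) :
    (∑ k ∈ Finset.range m, (((-1 : ℚ) ^ (k + 1)) / k) • x ^ k) ^ m = 0 := by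
  rw [logSum_eq_aeval]
  refine aeval_pow_eq_zero_of_coeff_zero ?_ h
  rw [coeff_trunc]
  split_ifs <;> simp

/-- The truncated logarithm at `x = 0` vanishes. [folklore] -/
theorem logSum_zero (m : ℕ) :
    (∑ k ∈ Finset.range m, (((-1 : ℚ) ^ (k + 1)) / k) • (0 : B) ^ k) = 0 := by
  refine Finset.sum_eq_zero fun k _ => ?_
  rcases k with _ | k
  · simp
  · simp

/-- Truncated logarithms of commuting elements commute. [folklore] -/
theorem commute_logSum {x y : B} (hxy : Commute x y) (m m' : ℕ) :
    Commute (∑ k ∈ Finset.range m, (((-1 : ℚ) ^ (k + 1)) / k) • x ^ k)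
      (∑ k ∈ Finset.range m', (((-1 : ℚ) ^ (k + 1)) / k) • y ^ k) := by
  refine Commute.sum_left _ _ _ fun i _ => Commute.sum_right _ _ _ fun j _ => ?_
  exact ((hxy.pow_pow i j).smul_left _).smul_right _

/-- **`exp (log (1 + x)) = 1 + x`** for `x ^ m = 0`, the logarithm truncated at level `m`
(from `exp_subst_log` by truncation).
Ref: Bourbaki, *Groupes et algèbres de Lie*, Ch. II §6 no. 1. [folklore] -/
theorem exp_logSum {x : B} {m : ℕ} (hm : x ^ m = 0) :
    IsNilpotent.exp (∑ k ∈ Finset.range m, (((-1 : ℚ) ^ (k + 1)) / k) • x ^ k) = 1 + x := by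
  rw [exp_eq_aeval (logSum_pow_eq_zero hm), logSum_eq_aeval, ← Polynomial.aeval_comp]
  have key : ∀ n < m, ((trunc m (exp ℚ)).comp (trunc m (log ℚ))).coeff n =
      ((1 : ℚ[X]) + Polynomial.X).coeff n := by
    intro n hn
    rw [← coeff_trunc_subst constantCoeff_log hn, exp_subst_log, coeff_trunc, if_pos hn]
    rw [← Polynomial.coeff_coe, Polynomial.coe_add, Polynomial.coe_one, Polynomial.coe_X]
  rw [aeval_eq_of_coeff_eq_of_pow_eq_zero key hm, map_add, map_one, aeval_X]

/-- **`log (exp x) = x`** for `x ^ m = 0`, the logarithm truncated at level `m`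
(`∑_{k<m} (-1)^(k+1) (exp x - 1)^k / k = x`, from `log_subst_exp_sub_one` by truncation).
Ref: Bourbaki, *Groupes et algèbres de Lie*, Ch. II §6 no. 1. [folklore] -/
theorem logSum_exp_sub_one {x : B} {m : ℕ} (hm : x ^ m = 0) :
    (∑ k ∈ Finset.range m, (((-1 : ℚ) ^ (k + 1)) / k) • (IsNilpotent.exp x - 1) ^ k) = x := by
  rcases Nat.eq_zero_or_pos m with rfl | hmpos
  · -- `x ^ 0 = 1 = 0`: the ring is trivial
    rw [pow_zero] at hm
    haveI : Subsingleton B := subsingleton_of_zero_eq_one hm.symm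
    exact Subsingleton.elim _ _
  have hE : IsNilpotent.exp x - 1 = aeval x (trunc m (exp ℚ) - 1) := by
    rw [map_sub, map_one, exp_eq_aeval hm]
  have hE0 : (trunc m (exp ℚ) - 1 : ℚ[X]).coeff 0 = 0 := by
    rw [Polynomial.coeff_sub, coeff_trunc, if_pos hmpos, Polynomial.coeff_one_zero,
      coeff_zero_eq_constantCoeff, constantCoeff_exp, sub_self]
  have hEm : (IsNilpotent.exp x - 1) ^ m = 0 := by
    rw [hE]; exact aeval_pow_eq_zero_of_coeff_zero hE0 hm
  rw [logSum_eq_aeval, hE, ← Polynomial.aeval_comp]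
  have htr : trunc m (exp ℚ - 1) = trunc m (exp ℚ) - 1 := by
    obtain ⟨k, rfl⟩ := Nat.exists_eq_succ_of_ne_zero hmpos.ne'
    rw [trunc_sub, trunc_one]
  have key : ∀ n < m, ((trunc m (log ℚ)).comp (trunc m (exp ℚ) - 1)).coeff n =
      (Polynomial.X : ℚ[X]).coeff n := by
    intro n hn
    have hc : PowerSeries.constantCoeff (exp ℚ - 1) = 0 := by
      rw [map_sub, map_one, constantCoeff_exp, sub_self]
    rw [← htr, ← coeff_trunc_subst hc hn, log_subst_exp_sub_one, coeff_trunc, if_pos hn,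
      ← Polynomial.coeff_coe, Polynomial.coe_X]
  rw [aeval_eq_of_coeff_eq_of_pow_eq_zero key hm, aeval_X]

/-- **The logarithm of a product of commuting unipotents** `(1 + x)(1 + y)` is the sum of the
logarithms (all truncated at a level `m` with `x ^ m = y ^ m = 0` and killing the sum of the two
logarithms, e.g. `m = n` for `n × n` matrices).
Ref: Bourbaki, *Groupes et algèbres de Lie*, Ch. II §6 no. 1. [folklore] -/
theorem logSum_mul_of_commute {x y : B} {m : ℕ} (hxy : Commute x y) (hx : x ^ m = 0)
    (hy : y ^ m = 0)
    (hs : ((∑ k ∈ Finset.range m, (((-1 : ℚ) ^ (k + 1)) / k) • x ^ k) +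
      ∑ k ∈ Finset.range m, (((-1 : ℚ) ^ (k + 1)) / k) • y ^ k) ^ m = 0) :
    (∑ k ∈ Finset.range m, (((-1 : ℚ) ^ (k + 1)) / k) • ((1 + x) * (1 + y) - 1) ^ k) =
      (∑ k ∈ Finset.range m, (((-1 : ℚ) ^ (k + 1)) / k) • x ^ k) +
        ∑ k ∈ Finset.range m, (((-1 : ℚ) ^ (k + 1)) / k) • y ^ k := by
  have hc := commute_logSum hxy m m
  have h := IsNilpotent.exp_add_of_commute hc ⟨m, logSum_pow_eq_zero hx⟩
    ⟨m, logSum_pow_eq_zero hy⟩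
  rw [exp_logSum hx, exp_logSum hy] at h
  rw [← h, logSum_exp_sub_one hs]

/-- The truncated logarithm commutes with actions by ring automorphisms (e.g. conjugation,
`ConjAct Bˣ`). [folklore] -/
theorem smul_logSum {G : Type*} [Monoid G] [MulSemiringAction G B] (g : G) (x : B) (m : ℕ) :
    g • (∑ k ∈ Finset.range m, (((-1 : ℚ) ^ (k + 1)) / k) • x ^ k) =
      ∑ k ∈ Finset.range m, (((-1 : ℚ) ^ (k + 1)) / k) • (g • x) ^ k := by
  rw [Finset.smul_sum]
  refine Finset.sum_congr rfl fun k _ => ?_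
  rw [← smul_pow']
  exact map_rat_smul (MulSemiringAction.toRingHom G B g) _ _

end Log

end Literature.RingTheory.PowerSeries.NilpotentLog
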